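import Literature.InformationTheory.QuantumCodes.ToricCodeThresholdProof
import Literature.InformationTheory.QuantumCodes.InhomogeneousDensityBound
import Literature.InformationTheory.QuantumCodes.GraphlikeSyndromes
import HarnessLib

/-!
# The toric-code threshold is robust to INHOMOGENEOUS noise: independent phase flips with site-dependent
# rates `p_ℓ ≤ ρ` fail with probability `≤ 2L²C r^L/(ν(1-r))`, `r = 2ν√(ρ(1-ρ))`, and `→ 0` for `4ν²ρ(1-ρ) < 1`

Topic `Literature/InformationTheory/QuantumCodes` (venture QEC, LADDER-QEC rung Q5, PARTITION row 09 "noise models";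
qec-type-09 gen 4, item 09.ANISO). The tree's code-capacity threshold for the toric code
(`ToricCodeThresholdProof.lean`, qec-lit-2: `failureProb_le_of_sawCountBound_holds`, `toricThreshold_of_sawCountBound_holds`,
and every Summits tier) assumes i.i.d. phase flips of ONE rate `p` ("at each lattice link … `Z` errors with probability `p`",
Dennis–Kitaev–Landahl–Preskill §4.1). Realistic noise is inhomogeneous. This file PROVES that the same certified bound
holds under INDEPENDENT BUT NON-IDENTICALLY DISTRIBUTED phase flips — link `ℓ` faulty with probability `r ℓ`, the
tree's `indepWeight r` (`CodeCapacityNoise.lean`) — with the single rate replaced by any uniform bound `ρ ≥ r ℓ`,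
`ρ ≤ 1/2`:

* `ToricCode.failureProbInhom L D r` — the failure probability of the decoder `D` under the inhomogeneous law
  (`failureProbInhom_const`: at constant rate it is `failureProb`);
* **`failureProbInhom_le_of_sawCountBound`** — for `L ≥ 3`, a minimum-weight decoder, `0 ≤ r ℓ ≤ ρ ≤ 1/2`,
  `cₙ(ℤ²) ≤ C νⁿ` and `r' := 2ν√(ρ(1-ρ)) < 1`: `Prob_fail ≤ 2 L² C r'^L / (ν (1 - r'))` (DKLP eq. (fail_2d));
* **`toricThreshold_inhom`** — for every minimum-weight decoder family and every family of rate functions with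
  `0 ≤ r_L ℓ ≤ ρ`, `4ν² ρ(1-ρ) < 1`: `Prob_fail → 0` as `L → ∞`.
Proof = the i.i.d. proof verbatim (polygon extraction `exists_polygon_of_failure`, census `card_polygons_le`, geometric
tail) with the i.i.d. half-density estimate replaced by the inhomogeneous one (`sum_indepWeight_le_of_cover`,
`InhomogeneousDensityBound.lean`). The monotone-coupling intuition "lower rates only help" is NOT termwise true for a
fixed decoder; the exponential-Markov bound is what makes it rigorous. All PROVED, 0 facts, kernel axioms.

## References
* [DennisEtAl2002] E. Dennis, A. Kitaev, A. Landahl, J. Preskill, *Topological quantum memory*, J. Math. Phys. 43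
  (2002) 4452–4505, arXiv:quant-ph/0110143, §4.1 (independent errors), §5.2 eqs. (27), (28), §5.3 eqs.
  (threshold_2d), (fail_2d).
-/

namespace Literature.InformationTheory.QuantumCodes

namespace ToricCode

open Finset Matrix Filter Topology
open Literature.Probability.RandomPlanarGeometry
open Literature.Probability.RandomPlanarGeometry.SAW.Zd

variable (L : ℕ)

open Classical in
/-- **Failure probability under inhomogeneous independent phase flips**: link `ℓ` carries an error with probability
`r ℓ`, independently; the total weight (`indepWeight r`) of the error chains on which the decoder `D` fails.
(definition) [cite: DennisEtAl2002, §4.1 (independent errors) and §5.2 (Prob_fail)] -/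
noncomputable def failureProbInhom [NeZero L] (D : ZDecoder L) (r : Edge L → ℝ) : ℝ :=
  ∑ e ∈ univ.filter (fun e : Chain L => ¬ D.Corrects (syn L) (boundaries L) e), indepWeight r (supp e)

variable {L}

/-- At a constant rate the inhomogeneous failure probability is the i.i.d. one. [cite: DennisEtAl2002, §5.2 (Prob_fail)] -/
theorem failureProbInhom_const [NeZero L] (D : ZDecoder L) (p : ℝ) :
    failureProbInhom L D (fun _ => p) = failureProb L D p := by
  unfold failureProbInhom failureProb
  exact Finset.sum_congr rfl fun e _ => (bernoulliWeight_eq_indepWeight p (supp e)).symm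

/-- A chain is determined by its support. [cite: DennisEtAl2002, §4.4 (n_E(ℓ) ∈ {0,1})] -/
theorem supp_injective_chain [NeZero L] : Function.Injective (supp : Chain L → Finset (Edge L)) :=
  fun x y h => by rw [← indicator_supp x, ← indicator_supp y, h]

/-- The walk-count hypothesis bounds the number of self-avoiding step words of `ℤ²`. [cite: DennisEtAl2002, §5.3 eq. (saw_d)] -/
theorem card_sawWords_two_le_of_bound {C ν : ℝ} (h : SAWCountBound C ν) (n : ℕ) :
    ((Word.sawWords 2 n).card : ℝ) ≤ C * ν ^ n := by
  rw [Word.card_sawWords, SAW.Zd.count_two]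
  exact h n

/-- The walk-count constant is non-negative (`c₀ = 1 ≤ C`). [cite: DennisEtAl2002, §5.3 eq. (saw_d)] -/
theorem sawCountBound_nonneg {C ν : ℝ} (h : SAWCountBound C ν) : 0 ≤ C := by
  have h0 := h 0
  rw [SAW.count_zero, pow_zero, mul_one, Nat.cast_one] at h0
  linarith

/-- **DKLP's finite-size bound under inhomogeneous independent noise, proved**: for `L ≥ 3`, a minimum-weight
decoder, rates `0 ≤ r ℓ ≤ ρ ≤ 1/2`, `cₙ(ℤ²) ≤ C νⁿ` and `r' := 2ν√(ρ(1-ρ)) < 1`,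
`Prob_fail ≤ 2 L² C r'^L / (ν (1 - r'))`. [cite: DennisEtAl2002, §5.2–5.3 eqs. (28), (29), (fail_2d)] -/
theorem failureProbInhom_le_of_sawCountBound {C ν : ℝ} (hν : 0 < ν) (hC : SAWCountBound C ν) (L : ℕ) [NeZero L]
    (hL : 3 ≤ L) (D : ZDecoder L) (hD : D.IsMinWeight (syn L) (cycles L) hammingNorm) {r : Edge L → ℝ} {ρ : ℝ}
    (hr0 : ∀ ℓ, 0 ≤ r ℓ) (hrρ : ∀ ℓ, r ℓ ≤ ρ) (hρ : ρ ≤ 1 / 2) (hr1 : 2 * ν * Real.sqrt (ρ * (1 - ρ)) < 1) :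
    failureProbInhom L D r ≤
      2 * (L : ℝ) ^ 2 * C * (2 * ν * Real.sqrt (ρ * (1 - ρ))) ^ L / (ν * (1 - 2 * ν * Real.sqrt (ρ * (1 - ρ)))) := by
  classical
  set s := Real.sqrt (ρ * (1 - ρ)) with hs
  set r' := 2 * ν * s with hr'
  have hs0 : 0 ≤ s := Real.sqrt_nonneg _
  have hr0' : 0 ≤ r' := by rw [hr']; positivity
  have h1r : 0 < 1 - r' := by linarith
  have hC0 : 0 ≤ C := sawCountBound_nonneg hC
  -- Step 1: the failing error chains, reindexed by their supports
  unfold failureProbInhom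
  set F := univ.filter (fun e : Chain L => ¬ D.Corrects (syn L) (boundaries L) e) with hF
  have hsum : ∑ e ∈ F, indepWeight r (supp e) = ∑ E ∈ F.image supp, indepWeight r E :=
    (Finset.sum_image fun e₁ _ e₂ _ h => supp_injective_chain h).symm
  rw [hsum]
  -- Step 2: the covering family of long self-avoiding polygons
  set Ps : Finset (Finset (Edge L)) := univ.filter (fun P =>
    (∃ (v : Vertex L) (w : List (Fin 2 × Bool)), IsPolygon v w ∧ polygonEdges v w = P) ∧ L ≤ P.card)
    with hPs
  have hcover : ∀ E ∈ F.image supp, ∃ P ∈ Ps,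
      ((fun P : Finset (Edge L) => P) P).card ≤ 2 * ((fun P : Finset (Edge L) => P) P ∩ E).card := by
    intro E hE
    obtain ⟨e, he, rfl⟩ := Finset.mem_image.1 hE
    have hfail : ¬ D.Corrects (syn L) (boundaries L) e := (Finset.mem_filter.1 he).2
    obtain ⟨v, w, hP, hLw, hhalf⟩ := exists_polygon_of_failure hL cycle_weight_ge_holds hD hfail
    refine ⟨polygonEdges v w, ?_, ?_⟩
    · rw [hPs, Finset.mem_filter]
      refine ⟨Finset.mem_univ _, ⟨v, w, hP, rfl⟩, ?_⟩
      rw [hP.card_polygonEdges]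
      exact hLw
    · simp only
      rw [hP.card_polygonEdges]
      exact hhalf
  have h1 := sum_indepWeight_le_of_cover hr0 hrρ hρ Ps (fun P : Finset (Edge L) => P) (F.image supp) hcover
  -- Step 3: grade the polygons by their number of links `H ∈ [L, #links]`
  set M := Fintype.card (Edge L) with hM
  have hmaps : ∀ P ∈ Ps, P.card ∈ Finset.Ico L (M + 1) := by
    intro P hP
    rw [hPs, Finset.mem_filter] at hP
    rw [Finset.mem_Ico]
    exact ⟨hP.2.2, Nat.lt_succ_of_le (Finset.card_le_univ P)⟩
  have h2 : ∑ P ∈ Ps, (2 * s) ^ P.card =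
      ∑ H ∈ Finset.Ico L (M + 1), ∑ P ∈ Ps.filter (fun P => P.card = H), (2 * s) ^ P.card :=
    (Finset.sum_fiberwise_of_maps_to hmaps _).symm
  -- Step 4: each fiber has at most `L² c_{H-1} ≤ L² C ν^{H-1}` polygons
  have hfiber : ∀ H ∈ Finset.Ico L (M + 1),
      ∑ P ∈ Ps.filter (fun P => P.card = H), (2 * s) ^ P.card ≤
        (L : ℝ) ^ 2 * (C * ν ^ (H - 1)) * (2 * s) ^ H := by
    intro H _
    have hcount : ((Ps.filter (fun P => P.card = H)).card : ℝ) ≤ (L : ℝ) ^ 2 * (C * ν ^ (H - 1)) := by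
      have hc := card_polygons_le hL H (Ps.filter (fun P => P.card = H)) (by
        intro P hP
        rw [Finset.mem_filter, hPs, Finset.mem_filter] at hP
        obtain ⟨⟨-, ⟨v, w, hPw, rfl⟩, -⟩, hH⟩ := hP
        exact ⟨v, w, hPw, by rw [← hH, hPw.card_polygonEdges], rfl⟩)
      calc ((Ps.filter (fun P => P.card = H)).card : ℝ)
          ≤ ((L ^ 2 * (Word.sawWords 2 (H - 1)).card : ℕ) : ℝ) := by exact_mod_cast hc
        _ = (L : ℝ) ^ 2 * ((Word.sawWords 2 (H - 1)).card : ℝ) := by push_cast; ring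
        _ ≤ (L : ℝ) ^ 2 * (C * ν ^ (H - 1)) :=
            mul_le_mul_of_nonneg_left (card_sawWords_two_le_of_bound hC (H - 1)) (by positivity)
    calc ∑ P ∈ Ps.filter (fun P => P.card = H), (2 * s) ^ P.card
        = ∑ P ∈ Ps.filter (fun P => P.card = H), (2 * s) ^ H :=
          Finset.sum_congr rfl fun P hP => by rw [(Finset.mem_filter.1 hP).2]
      _ = ((Ps.filter (fun P => P.card = H)).card : ℝ) * (2 * s) ^ H := by
          rw [Finset.sum_const, nsmul_eq_mul]
      _ ≤ (L : ℝ) ^ 2 * (C * ν ^ (H - 1)) * (2 * s) ^ H :=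
          mul_le_mul_of_nonneg_right hcount (pow_nonneg (by positivity) _)
  -- Step 5: the geometric tail
  have hterm : ∀ H ∈ Finset.Ico L (M + 1),
      (L : ℝ) ^ 2 * (C * ν ^ (H - 1)) * (2 * s) ^ H = (L : ℝ) ^ 2 * C / ν * r' ^ H := by
    intro H hH
    have hH1 : 1 ≤ H := le_trans (by omega : 1 ≤ L) (Finset.mem_Ico.1 hH).1
    obtain ⟨H', rfl⟩ : ∃ H', H = H' + 1 := ⟨H - 1, by omega⟩
    simp only [Nat.add_sub_cancel, hr']
    field_simp
    ring
  have h3 : ∑ H ∈ Finset.Ico L (M + 1), (L : ℝ) ^ 2 * (C * ν ^ (H - 1)) * (2 * s) ^ H =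
      (L : ℝ) ^ 2 * C / ν * ∑ H ∈ Finset.Ico L (M + 1), r' ^ H := by
    rw [Finset.mul_sum]
    exact Finset.sum_congr rfl hterm
  have hgeom := geom_tail_le hr0' hr1 L (M + 1)
  calc ∑ E ∈ F.image supp, indepWeight r E
      ≤ ∑ P ∈ Ps, (2 * s) ^ P.card := h1
    _ = ∑ H ∈ Finset.Ico L (M + 1), ∑ P ∈ Ps.filter (fun P => P.card = H), (2 * s) ^ P.card := h2
    _ ≤ ∑ H ∈ Finset.Ico L (M + 1), (L : ℝ) ^ 2 * (C * ν ^ (H - 1)) * (2 * s) ^ H :=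
        Finset.sum_le_sum hfiber
    _ = (L : ℝ) ^ 2 * C / ν * ∑ H ∈ Finset.Ico L (M + 1), r' ^ H := h3
    _ ≤ (L : ℝ) ^ 2 * C / ν * (r' ^ L / (1 - r')) := mul_le_mul_of_nonneg_left hgeom (by positivity)
    _ ≤ 2 * (L : ℝ) ^ 2 * C * r' ^ L / (ν * (1 - r')) := by
        have hX : 0 ≤ (L : ℝ) ^ 2 * C / ν * (r' ^ L / (1 - r')) := by positivity
        have hν0 : ν ≠ 0 := hν.ne'
        have h1r0 : 1 - r' ≠ 0 := h1r.ne'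
        have he : 2 * (L : ℝ) ^ 2 * C * r' ^ L / (ν * (1 - r')) =
            2 * ((L : ℝ) ^ 2 * C / ν * (r' ^ L / (1 - r'))) := by
          field_simp
        rw [he]
        linarith

/-- The inhomogeneous failure probability is non-negative for rates in `[0, 1]`. [cite: DennisEtAl2002, §5.2 (Prob_fail)] -/
theorem failureProbInhom_nonneg [NeZero L] (D : ZDecoder L) {r : Edge L → ℝ} (hr0 : ∀ ℓ, 0 ≤ r ℓ)
    (hr1 : ∀ ℓ, r ℓ ≤ 1) : 0 ≤ failureProbInhom L D r := by
  unfold failureProbInhom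
  exact Finset.sum_nonneg fun e _ => indepWeight_nonneg hr0 hr1 _

/-- **The toric-code threshold under inhomogeneous independent noise, proved.** For `cₙ(ℤ²) ≤ C νⁿ`, every family of
minimum-weight decoders of the `(L+1) × (L+1)` toric codes and every family of link-dependent rates with
`0 ≤ r_L ℓ ≤ ρ` and `4ν² ρ(1-ρ) < 1` (`ρ ≤ 1/2`): `Prob_fail → 0` as `L → ∞` — the certified i.i.d. threshold
`p₀(ν)` bounds the inhomogeneous threshold region `{sup_ℓ r ℓ < p₀(ν)}`.
[cite: DennisEtAl2002, §5.3 eqs. (threshold_2d), (fail_2d)] -/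
theorem toricThreshold_inhom {C ν : ℝ} (hν : 0 < ν) (hC : SAWCountBound C ν) {D : (L : ℕ) → ZDecoder (L + 1)}
    (hD : ∀ L, (D L).IsMinWeight (syn (L + 1)) (cycles (L + 1)) hammingNorm) {r : (L : ℕ) → Edge (L + 1) → ℝ}
    {ρ : ℝ} (hr0 : ∀ L ℓ, 0 ≤ r L ℓ) (hrρ : ∀ L ℓ, r L ℓ ≤ ρ) (hρ : ρ ≤ 1 / 2) (h4 : 4 * ν ^ 2 * (ρ * (1 - ρ)) < 1) :
    Tendsto (fun L => failureProbInhom (L + 1) (D L) (r L)) atTop (𝓝 0) := by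
  have hρ0 : 0 ≤ ρ := (hr0 0 ((0 : Vertex 1), 0)).trans (hrρ 0 _)
  set s := Real.sqrt (ρ * (1 - ρ)) with hs
  set r' := 2 * ν * s with hr'
  have hs0 : 0 ≤ s := Real.sqrt_nonneg _
  have hr0' : 0 ≤ r' := by rw [hr']; positivity
  have hρρ : 0 ≤ ρ * (1 - ρ) := mul_nonneg hρ0 (by linarith)
  have hC0 : 0 ≤ C := sawCountBound_nonneg hC
  have hr1 : r' < 1 := by
    have hsq : r' ^ 2 = 4 * ν ^ 2 * (ρ * (1 - ρ)) := by
      rw [hr', mul_pow, mul_pow, hs, Real.sq_sqrt hρρ]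
      ring
    have h : r' ^ 2 < 1 := by rw [hsq]; exact h4
    have := (sq_lt_one_iff_abs_lt_one r').1 h
    rwa [abs_of_nonneg hr0'] at this
  have h1r : 0 < 1 - r' := by linarith
  have hbound : ∀ L : ℕ, 2 ≤ L →
      failureProbInhom (L + 1) (D L) (r L) ≤ 2 * ((L + 1 : ℕ) : ℝ) ^ 2 * C * r' ^ (L + 1) / (ν * (1 - r')) := by
    intro L hL2
    exact failureProbInhom_le_of_sawCountBound hν hC (L + 1) (by omega) (D L) (hD L) (hr0 L) (hrρ L) hρ hr1
  have hnonneg : ∀ L : ℕ, 0 ≤ failureProbInhom (L + 1) (D L) (r L) := fun L =>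
    failureProbInhom_nonneg (D L) (hr0 L) fun ℓ => (hrρ L ℓ).trans (by linarith)
  have hlim : Tendsto (fun L : ℕ => 2 * ((L + 1 : ℕ) : ℝ) ^ 2 * C * r' ^ (L + 1) / (ν * (1 - r')))
      atTop (𝓝 0) := by
    have h0 := tendsto_pow_const_mul_const_pow_of_abs_lt_one 2 (show |r'| < 1 by rwa [abs_of_nonneg hr0'])
    have h1 : Tendsto (fun L : ℕ => ((L + 1 : ℕ) : ℝ) ^ 2 * r' ^ (L + 1)) atTop (𝓝 0) :=
      (Filter.tendsto_add_atTop_iff_nat 1).2 h0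
    have h2 := h1.const_mul (2 * C / (ν * (1 - r')))
    rw [mul_zero] at h2
    refine h2.congr fun L => ?_
    have hν0 : ν ≠ 0 := hν.ne'
    have h1r0 : 1 - r' ≠ 0 := h1r.ne'
    field_simp
  refine squeeze_zero' (Filter.Eventually.of_forall hnonneg) ?_ hlim
  rw [Filter.eventually_atTop]
  exact ⟨2, fun L hL => hbound L hL⟩

end ToricCode

end Literature.InformationTheory.QuantumCodes
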